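import Mathlib.GroupTheory.FiniteAbelian.Basic
import Literature.Computability.AlgebraicComplexity.PrattTrapezoidValSTPP
import Literature.Computability.AlgebraicComplexity.PrattTrapezoidValSDPP
import HarnessLib

/-!
# Pratt 2024, proof of Thm. 4.7: bookkeeping (cyclic factors, balanced pairs, `K³`)

K. Pratt, *On generalized corners and matrix multiplication*, arXiv:2309.03878 [Pratt2024], proof
of Thm. 4.7 (p. 10).  Fourth step of the discharge of the named fact `pratt2024_thm47`
(`PrattTrapezoidVal.lean`); everything here is PROVED and elementary:

* `exists_pi_zmod_decomp` — the decomposition `G = ℤ_{m₁} × ⋯ × ℤ_{m_k}` of the printed proof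
  with the bookkeeping its last display needs: `H ≃ ∏_{j<k} ℤ/m_j` with prime powers `m_j ≥ 2`
  (structure theorem, `AddCommGroup.equiv_directSum_zmod_of_finite`, trivial factors removed),
  `k = k_L + Σ_{2 ≤ q ≤ L} r_q` where `L^{k_L} ≤ |H|` ("the number of `mᵢ`'s which are greater
  than `ℓ` is trivially less than `log_ℓ |G³|`") and, for every value `q ≤ L` that occurs, an
  isomorphism `H ≃ (ℤ/q)^{r_q} × G'` (the homocyclic component on which the slice-rank input
  `sum_card_div_le_of_addEquiv_piZMod` acts: "the number of `mᵢ`'s which are at most `ℓ` is at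
  most `log₂(|G³|^c)`").
* `nonempty_addEquiv_triple` — `H ≃ (ℤ/q)^κ × G'` gives `H³ ≃ (ℤ/q)^{κ ⊔ κ ⊔ κ} × G'³`.
* `sum_card_le_card_of_sdpp_left/right` — for SDPP pairs `(Aᵢ, Bᵢ)` (with nonempty partners)
  the `Aᵢ`, resp. `Bᵢ`, are pairwise disjoint, so `Σ |Aᵢ| ≤ |H|`, `Σ |Bᵢ| ≤ |H|`.
* `exists_balanced_indices` — Markov: given `Σ αᵢ ≤ S`, `Σ βᵢ ≤ S` over `i < n`, at least `n/2`
  indices have `αᵢ n ≤ 4S` and `βᵢ n ≤ 4S` (the balanced sub-family on which Thm. 3.3 of BCCGNSU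
  is efficient; the printed proof is silent on this point).
* `card_mul_rpow_le_sum_sdpp`, `card_mul_div_le_sum_div_sdpp` — the two lower bounds for the
  CKSU family `(A_x, B_x, C_x)`: `|ι₀| Y³ ≤ Σₓ |A_x||B_x||C_x|` when `Y ≤ |Aᵢ||Bᵢ|` for all `i`,
  and `|ι₀| Y³/(3Z²) ≤ Σₓ |A_x||B_x||C_x|/(|A_x|+|B_x|+|C_x|)` when moreover all the `|Aᵢ|, |Bᵢ|`
  involved are `≤ Z`.

## References

* [Pratt2024] K. Pratt, arXiv:2309.03878, proof of Thm. 4.7 (p. 10).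
-/

namespace Literature.Computability.AlgebraicComplexity

open Finset

/-! ### Cyclic factors -/

section Decomp

/-- **The cyclic decomposition with its bookkeeping** (see the module docstring): for a finite
abelian group `H` and a threshold `L`, `H ≃ ∏_{j<k} ℤ/m_j` with `m_j ≥ 2`,
`k = k_L + Σ_{q ∈ [2,L]} r_q`, `L^{k_L} ≤ |H|`, `∏ m_j = |H|`, and for each `q ∈ [2, L]` with
`r_q ≠ 0`: `q = p^s` is a prime power and `H ≃ (ℤ/q)^κ × G'` with `|κ| = r_q`.
[cite: Pratt2024, Thm. 4.7 (proof)] -/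
theorem exists_pi_zmod_decomp (H : Type) [AddCommGroup H] [Fintype H] (L : ℕ) :
    ∃ (k : ℕ) (m : Fin k → ℕ), (∀ j, 2 ≤ m j) ∧ Nonempty (H ≃+ Π j, ZMod (m j)) ∧
      ∏ j, m j = Fintype.card H ∧
      ∃ (kL : ℕ) (r : ℕ → ℕ), k = kL + ∑ q ∈ Icc 2 L, r q ∧ L ^ kL ≤ Fintype.card H ∧
        ∀ q ∈ Icc 2 L, r q ≠ 0 → ∃ (p : ℕ) (_ : p.Prime) (s : ℕ), q = p ^ s ∧
          ∃ (κ : Type) (_ : Fintype κ) (_ : DecidableEq κ) (G' : Type) (_ : AddCommGroup G')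
            (_ : Fintype G') (_ : DecidableEq G'), Fintype.card κ = r q ∧
            Nonempty (H ≃+ (κ → ZMod q) × G') := by
  classical
  obtain ⟨ι, _, pr, hpr, ex, ⟨f⟩⟩ := AddCommGroup.equiv_directSum_zmod_of_finite H
  set Q : ι → ℕ := fun i => pr i ^ ex i with hQ
  have hQpos : ∀ i, 0 < Q i := fun i => pow_pos (hpr i).pos _
  haveI : ∀ i, NeZero (Q i) := fun i => ⟨(hQpos i).ne'⟩
  let g : H ≃+ (Π i, ZMod (Q i)) := f.trans (DirectSum.addEquivProd _)
  -- remove the trivial factors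
  let P : ι → Prop := fun i => 1 < Q i
  let g₁ : (Π i, ZMod (Q i)) ≃+
      (Π i : {i // P i}, ZMod (Q i.1)) × (Π i : {i // ¬ P i}, ZMod (Q i.1)) :=
    (RingEquiv.piEquivPiSubtypeProd P (fun i => ZMod (Q i))).toAddEquiv
  haveI : ∀ i : {i // ¬ P i}, Subsingleton (ZMod (Q i.1)) := fun i =>
    ZMod.subsingleton_iff.2 (by have h1 := hQpos i.1; have h2 := i.2; simp only [P] at h2; omega)
  haveI : Unique (Π i : {i // ¬ P i}, ZMod (Q i.1)) := uniqueOfSubsingleton 0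
  let g₂ : H ≃+ (Π i : {i // P i}, ZMod (Q i.1)) := g.trans (g₁.trans AddEquiv.prodUnique)
  -- reindex by `Fin k`
  set k := Fintype.card {i // P i} with hk
  let σ : {i // P i} ≃ Fin k := Fintype.equivFin _
  let m : Fin k → ℕ := fun j => Q (σ.symm j).1
  haveI : ∀ j, NeZero (m j) := fun j => ⟨(hQpos _).ne'⟩
  let g₃ : (Π i : {i // P i}, ZMod (Q i.1)) ≃+ (Π j : Fin k, ZMod (m j)) :=
    AddEquiv.mk' (Equiv.piCongrLeft' (fun i : {i // P i} => ZMod (Q i.1)) σ) fun _ _ => rfl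
  let e : H ≃+ (Π j : Fin k, ZMod (m j)) := g₂.trans g₃
  have hm2 : ∀ j, 2 ≤ m j := fun j => (σ.symm j).2
  have hcardH : ∏ j, m j = Fintype.card H := by
    rw [Fintype.card_congr e.toEquiv, Fintype.card_pi]
    simp only [ZMod.card]
  -- multiplicities
  set r : ℕ → ℕ := fun q => #(univ.filter fun j : Fin k => m j = q) with hr
  set kL : ℕ := #(univ.filter fun j : Fin k => L < m j) with hkL
  refine ⟨k, m, hm2, ⟨e⟩, hcardH, kL, r, ?_, ?_, ?_⟩
  · -- `k = kL + Σ_q r q`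
    have hmaps : Set.MapsTo m ↑(univ.filter fun j : Fin k => ¬ L < m j) ↑(Icc 2 L) := by
      intro j hj
      rw [coe_filter] at hj
      exact mem_coe.2 (mem_Icc.2 ⟨hm2 j, not_lt.1 hj.2⟩)
    have hfib := card_eq_sum_card_fiberwise hmaps
    have hfib' : #(univ.filter fun j : Fin k => ¬ L < m j) = ∑ q ∈ Icc 2 L, r q := by
      rw [hfib]
      refine sum_congr rfl fun q hq => ?_
      simp only [hr]
      congr 1
      ext j
      simp only [mem_filter, mem_univ, true_and, and_iff_right_iff_imp]
      intro h
      rw [h, not_lt]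
      exact (mem_Icc.1 hq).2
    have hsum := card_filter_add_card_filter_not (s := (univ : Finset (Fin k)))
      (fun j : Fin k => L < m j)
    rw [card_univ, Fintype.card_fin, hfib'] at hsum
    rw [← hsum]
  · -- `L ^ kL ≤ |H|`
    rw [← hcardH]
    calc L ^ kL ≤ ∏ j ∈ univ.filter (fun j : Fin k => L < m j), m j :=
          pow_card_le_prod _ _ _ fun j hj => (mem_filter.1 hj).2.le
      _ ≤ ∏ j, m j :=
          prod_le_prod_of_subset_of_one_le' (filter_subset _ _) fun j _ _ => by
            have := hm2 j; omega
  · -- the homocyclic component of a value `q`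
    intro q hq hrq
    obtain ⟨j₀, hj₀⟩ : ∃ j₀ : Fin k, m j₀ = q := by
      by_contra hne
      push Not at hne
      apply hrq
      simp only [hr, card_eq_zero, filter_eq_empty_iff]
      exact fun j _ => hne j
    refine ⟨pr (σ.symm j₀).1, hpr _, ex (σ.symm j₀).1, hj₀.symm, ?_⟩
    set P' : Fin k → Prop := fun j => m j = q with hP'
    let e₁ : (Π j : Fin k, ZMod (m j)) ≃+
        (Π j : {j // P' j}, ZMod (m j.1)) × (Π j : {j // ¬ P' j}, ZMod (m j.1)) :=
      (RingEquiv.piEquivPiSubtypeProd P' (fun j => ZMod (m j))).toAddEquiv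
    let e₂ : (Π j : {j // P' j}, ZMod (m j.1)) ≃+ ({j // P' j} → ZMod q) :=
      AddEquiv.piCongrRight fun j => (ZMod.ringEquivCongr j.2).toAddEquiv
    refine ⟨{j // P' j}, inferInstance, inferInstance, (Π j : {j // ¬ P' j}, ZMod (m j.1)),
      inferInstance, inferInstance, inferInstance, ?_,
      ⟨e.trans (e₁.trans (AddEquiv.prodCongr e₂ (AddEquiv.refl _)))⟩⟩
    rw [Fintype.card_subtype]

end Decomp

/-! ### `K³` -/

section Triple

/-- From `H ≃ (ℤ/q)^κ × G'` to `H × H × H ≃ (ℤ/q)^{κ ⊔ κ ⊔ κ} × (G' × G' × G')` (regroup with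
`prodProdProdComm`, then merge the three coordinate blocks). [folklore] -/
theorem nonempty_addEquiv_triple {H : Type*} [AddCommGroup H] {q : ℕ} {κ : Type*} {G' : Type*}
    [AddCommGroup G'] (e : H ≃+ (κ → ZMod q) × G') :
    Nonempty ((H × H × H) ≃+ ((κ ⊕ (κ ⊕ κ) → ZMod q) × (G' × (G' × G')))) := by
  let P := κ → ZMod q
  let e₃ : (H × H × H) ≃+ (P × G') × ((P × G') × (P × G')) :=
    AddEquiv.prodCongr e (AddEquiv.prodCongr e e)
  let e₄ : (P × G') × ((P × G') × (P × G')) ≃+ (P × G') × ((P × P) × (G' × G')) :=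
    AddEquiv.prodCongr (AddEquiv.refl _) (AddEquiv.prodProdProdComm P G' P G')
  let e₅ : (P × G') × ((P × P) × (G' × G')) ≃+ (P × (P × P)) × (G' × (G' × G')) :=
    AddEquiv.prodProdProdComm P G' (P × P) (G' × G')
  let u₂ : (P × P) ≃+ (κ ⊕ κ → ZMod q) :=
    (AddEquiv.mk' (Equiv.sumArrowEquivProdArrow κ κ (ZMod q)) fun _ _ => rfl).symm
  let u₃ : (P × (κ ⊕ κ → ZMod q)) ≃+ (κ ⊕ (κ ⊕ κ) → ZMod q) :=
    (AddEquiv.mk' (Equiv.sumArrowEquivProdArrow κ (κ ⊕ κ) (ZMod q)) fun _ _ => rfl).symm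
  let e₆ : (P × (P × P)) × (G' × (G' × G')) ≃+ ((κ ⊕ (κ ⊕ κ) → ZMod q) × (G' × (G' × G'))) :=
    AddEquiv.prodCongr ((AddEquiv.prodCongr (AddEquiv.refl P) u₂).trans u₃) (AddEquiv.refl _)
  exact ⟨e₃.trans (e₄.trans (e₅.trans e₆))⟩

end Triple

/-! ### SDPP pairs: disjointness and a balanced sub-family -/

section Balanced

variable {H : Type*} [AddCommGroup H] [Fintype H] [DecidableEq H] {n : ℕ} {A B : Fin n → Finset H}

/-- For SDPP pairs the `Aᵢ` are pairwise disjoint (indices `(i, k, k)` in the cross condition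
with `a = a'`, `b = b'`), hence `Σᵢ |Aᵢ| ≤ |H|`; needs the `Bᵢ` nonempty.
[cite: Pratt2024, Def. 2.4] -/
theorem sum_card_le_card_of_sdpp_left
    (hSD : ∀ i j k : Fin n, ∀ a ∈ A i, ∀ a' ∈ A j, ∀ b ∈ B j, ∀ b' ∈ B k,
      (a - a') + (b - b') = 0 → i = k)
    (hB : ∀ i, (B i).Nonempty) : ∑ i, #(A i) ≤ Fintype.card H := by
  have hdisj : (↑(univ : Finset (Fin n)) : Set (Fin n)).PairwiseDisjoint A := by
    intro i _ k _ hik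
    rw [Function.onFun, disjoint_left]
    intro a hai hak
    obtain ⟨b, hb⟩ := hB k
    exact hik (hSD i k k a hai a hak b hb b hb (by simp))
  rw [← card_biUnion hdisj]
  exact card_le_univ _

/-- For SDPP pairs the `Bᵢ` are pairwise disjoint (indices `(i, i, k)` with `a = a'`, `b = b'`),
hence `Σᵢ |Bᵢ| ≤ |H|`; needs the `Aᵢ` nonempty. [cite: Pratt2024, Def. 2.4] -/
theorem sum_card_le_card_of_sdpp_right
    (hSD : ∀ i j k : Fin n, ∀ a ∈ A i, ∀ a' ∈ A j, ∀ b ∈ B j, ∀ b' ∈ B k,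
      (a - a') + (b - b') = 0 → i = k)
    (hA : ∀ i, (A i).Nonempty) : ∑ i, #(B i) ≤ Fintype.card H := by
  have hdisj : (↑(univ : Finset (Fin n)) : Set (Fin n)).PairwiseDisjoint B := by
    intro i _ k _ hik
    rw [Function.onFun, disjoint_left]
    intro b hbi hbk
    obtain ⟨a, ha⟩ := hA i
    exact hik (hSD i i k a ha a ha b hbi b hbk (by simp))
  rw [← card_biUnion hdisj]
  exact card_le_univ _

omit [Fintype H] [DecidableEq H] in
/-- **Markov, twice**: if `Σᵢ αᵢ ≤ S` and `Σᵢ βᵢ ≤ S` over `i < n`, the indices with `αᵢ n ≤ 4S`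
and `βᵢ n ≤ 4S` number at least `n/2` (each of the two exceptional sets has `≤ n/4` elements).
[folklore] -/
theorem exists_balanced_indices {S : ℕ} (α β : Fin n → ℕ) (hα : ∑ i, α i ≤ S)
    (hβ : ∑ i, β i ≤ S) :
    ∃ good : Finset (Fin n), n ≤ 2 * #good ∧ ∀ i ∈ good, α i * n ≤ 4 * S ∧ β i * n ≤ 4 * S := by
  classical
  set good := univ.filter fun i : Fin n => α i * n ≤ 4 * S ∧ β i * n ≤ 4 * S with hgood
  set badα := univ.filter fun i : Fin n => 4 * S < α i * n with hbadα
  set badβ := univ.filter fun i : Fin n => 4 * S < β i * n with hbadβ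
  refine ⟨good, ?_, fun i hi => (mem_filter.1 hi).2⟩
  have hcover : (univ : Finset (Fin n)) ⊆ good ∪ badα ∪ badβ := by
    intro i _
    simp only [hgood, hbadα, hbadβ, mem_union, mem_filter, mem_univ, true_and]
    omega
  have hn : n ≤ #good + #badα + #badβ := by
    calc n = #(univ : Finset (Fin n)) := by rw [card_univ, Fintype.card_fin]
      _ ≤ #(good ∪ badα ∪ badβ) := card_le_card hcover
      _ ≤ #(good ∪ badα) + #badβ := card_union_le _ _
      _ ≤ #good + #badα + #badβ := Nat.add_le_add_right (card_union_le _ _) _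
  -- each exceptional set has at most `n/4` elements
  have key : ∀ (γ : Fin n → ℕ), ∑ i, γ i ≤ S →
      4 * #(univ.filter fun i : Fin n => 4 * S < γ i * n) ≤ n := by
    intro γ hγ
    set bad := univ.filter fun i : Fin n => 4 * S < γ i * n with hbad
    rcases Nat.eq_zero_or_pos S with hS | hS
    · -- `S = 0`: all `γ i = 0`, the set is empty
      have h0 : ∀ i, γ i = 0 := fun i => by
        have := (sum_eq_zero_iff_of_nonneg fun j _ => Nat.zero_le (γ j)).1 (by omega) i (mem_univ _)
        exact this
      have hempty : bad = ∅ := by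
        rw [hbad, filter_eq_empty_iff]
        intro i _
        rw [h0 i, hS]
        omega
      rw [hempty, card_empty]
      omega
    · have h1 : #bad * (4 * S) ≤ ∑ i ∈ bad, γ i * n := by
        rw [← smul_eq_mul, ← sum_const]
        exact sum_le_sum fun i hi => ((mem_filter.1 hi).2).le
      have h2 : ∑ i ∈ bad, γ i * n ≤ S * n := by
        rw [← sum_mul]
        exact Nat.mul_le_mul_right _ ((sum_le_sum_of_subset_of_nonneg (filter_subset _ _)
          fun i _ _ => Nat.zero_le _).trans hγ)
      have h3 : #bad * 4 * S ≤ n * S := by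
        calc #bad * 4 * S = #bad * (4 * S) := by ring
          _ ≤ S * n := h1.trans h2
          _ = n * S := by ring
      have := Nat.le_of_mul_le_mul_right h3 hS
      omega
  have hA : 4 * #badα ≤ n := key α hα
  have hB : 4 * #badβ ≤ n := key β hβ
  omega

end Balanced

/-! ### Lower bounds for the CKSU family -/

section LowerBounds

variable {H : Type*} [AddCommGroup H] {n : ℕ} {A B : Fin n → Finset H} {ι₀ : Type*} [Fintype ι₀]

/-- `|ι₀| · Y³ ≤ Σₓ |A_x||B_x||C_x|` for the CKSU family when `Y ≤ |Aᵢ||Bᵢ|` for every `i`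
("an STPP with `n^{2-o(1)}` triples of sets of size `n^{2-o(1)}`", proof of Pratt's Thm. 4.7).
[cite: Pratt2024, Thm. 4.7 (proof)] -/
theorem card_mul_pow_le_sum_sdpp (i₁ i₂ i₃ : ι₀ → Fin n) {Y : ℝ} (hY : 0 ≤ Y)
    (hAB : ∀ i : Fin n, Y ≤ (#(A i) * #(B i) : ℕ)) :
    Fintype.card ι₀ * Y ^ 3 ≤ ((∑ x, #(A (i₁ x) ×ˢ (({0} : Finset H) ×ˢ B (i₃ x))) *
      #(B (i₁ x) ×ˢ (A (i₂ x) ×ˢ ({0} : Finset H))) *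
      #(({0} : Finset H) ×ˢ (B (i₂ x) ×ˢ A (i₃ x))) : ℕ) : ℝ) := by
  push_cast
  rw [← nsmul_eq_mul, ← Finset.card_univ, ← Finset.sum_const]
  refine Finset.sum_le_sum fun x _ => ?_
  have h := card_mul_card_mul_card_sdpp (A := A) (B := B) i₁ i₂ i₃ x
  have h' : (#(A (i₁ x) ×ˢ (({0} : Finset H) ×ˢ B (i₃ x))) : ℝ) *
      #(B (i₁ x) ×ˢ (A (i₂ x) ×ˢ ({0} : Finset H))) * #(({0} : Finset H) ×ˢ (B (i₂ x) ×ˢ A (i₃ x))) =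
      ((#(A (i₁ x)) * #(B (i₁ x)) : ℕ) : ℝ) * ((#(A (i₂ x)) * #(B (i₂ x)) : ℕ) : ℝ) *
        ((#(A (i₃ x)) * #(B (i₃ x)) : ℕ) : ℝ) := by
    exact_mod_cast h
  rw [h', pow_three, ← mul_assoc]
  have h1 := hAB (i₁ x)
  have h2 := hAB (i₂ x)
  have h3 := hAB (i₃ x)
  exact mul_le_mul (mul_le_mul h1 h2 hY (le_trans hY h1)) h3 hY
    (mul_nonneg (le_trans hY h1) (le_trans hY h2))

/-- `|ι₀| · Y³ / (3Z²) ≤ Σₓ |A_x||B_x||C_x| / (|A_x|+|B_x|+|C_x|)` for the CKSU family when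
`0 < Y ≤ |Aᵢ||Bᵢ|` for every `i` and the `|Aᵢ|, |Bᵢ|` at the indices used are `≤ Z` (the size
of the border tricolored sum-free set of BCCGNSU Thm. 3.3 for a balanced family).
[cite: Pratt2024, Thm. 4.7 (proof)] -/
theorem card_mul_pow_div_le_sum_div_sdpp (i₁ i₂ i₃ : ι₀ → Fin n) {Y Z : ℝ} (hY : 0 < Y)
    (hAB : ∀ i : Fin n, Y ≤ (#(A i) * #(B i) : ℕ))
    (hZ : ∀ x, (#(A (i₁ x)) : ℝ) ≤ Z ∧ (#(B (i₁ x)) : ℝ) ≤ Z ∧ (#(A (i₂ x)) : ℝ) ≤ Z ∧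
      (#(B (i₂ x)) : ℝ) ≤ Z ∧ (#(A (i₃ x)) : ℝ) ≤ Z ∧ (#(B (i₃ x)) : ℝ) ≤ Z) :
    Fintype.card ι₀ * Y ^ 3 / (3 * Z ^ 2) ≤
      ∑ x, ((#(A (i₁ x) ×ˢ (({0} : Finset H) ×ˢ B (i₃ x))) *
        #(B (i₁ x) ×ˢ (A (i₂ x) ×ˢ ({0} : Finset H))) *
        #(({0} : Finset H) ×ˢ (B (i₂ x) ×ˢ A (i₃ x))) : ℕ) : ℝ) /
        (#(A (i₁ x) ×ˢ (({0} : Finset H) ×ˢ B (i₃ x))) +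
          #(B (i₁ x) ×ˢ (A (i₂ x) ×ˢ ({0} : Finset H))) +
          #(({0} : Finset H) ×ˢ (B (i₂ x) ×ˢ A (i₃ x)))) := by
  have hsum : Fintype.card ι₀ * Y ^ 3 / (3 * Z ^ 2) = ∑ _x : ι₀, Y ^ 3 / (3 * Z ^ 2) := by
    rw [Finset.sum_const, Finset.card_univ, nsmul_eq_mul, mul_div_assoc]
  rw [hsum]
  refine Finset.sum_le_sum fun x _ => ?_
  obtain ⟨hA1, hB1, hA2, hB2, hA3, hB3⟩ := hZ x
  have h1 := hAB (i₁ x)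
  have h2 := hAB (i₂ x)
  have h3 := hAB (i₃ x)
  push_cast at h1 h2 h3
  -- positivity of all the cardinalities involved
  have pos : ∀ {a b : ℝ}, 0 ≤ a → 0 ≤ b → Y ≤ a * b → 0 < a ∧ 0 < b := by
    intro a b ha hb hab
    have hab' : 0 < a * b := hY.trans_le hab
    exact ⟨lt_of_le_of_ne ha fun h0 => by rw [← h0, zero_mul] at hab'; exact lt_irrefl _ hab',
      lt_of_le_of_ne hb fun h0 => by rw [← h0, mul_zero] at hab'; exact lt_irrefl _ hab'⟩
  obtain ⟨pA1, pB1⟩ := pos (Nat.cast_nonneg _) (Nat.cast_nonneg _) h1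
  obtain ⟨pA2, pB2⟩ := pos (Nat.cast_nonneg _) (Nat.cast_nonneg _) h2
  obtain ⟨pA3, pB3⟩ := pos (Nat.cast_nonneg _) (Nat.cast_nonneg _) h3
  simp only [card_product, card_singleton, one_mul, mul_one]
  push_cast
  have hZ0 : 0 < Z := pA1.trans_le hA1
  refine div_le_div₀ (by positivity) ?_ (by positivity) ?_
  · -- `Y³ ≤ PQR`
    calc Y ^ 3 = Y * Y * Y := by ring
      _ ≤ (#(A (i₁ x)) * #(B (i₁ x)) : ℝ) * (#(A (i₂ x)) * #(B (i₂ x))) *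
          (#(A (i₃ x)) * #(B (i₃ x))) :=
          mul_le_mul (mul_le_mul h1 h2 hY.le (by positivity)) h3 hY.le (by positivity)
      _ = _ := by ring
  · -- `P + Q + R ≤ 3 Z²`
    have e1 : (#(A (i₁ x)) : ℝ) * #(B (i₃ x)) ≤ Z * Z :=
      mul_le_mul hA1 hB3 (Nat.cast_nonneg _) hZ0.le
    have e2 : (#(B (i₁ x)) : ℝ) * #(A (i₂ x)) ≤ Z * Z :=
      mul_le_mul hB1 hA2 (Nat.cast_nonneg _) hZ0.le
    have e3 : (#(B (i₂ x)) : ℝ) * #(A (i₃ x)) ≤ Z * Z :=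
      mul_le_mul hB2 hA3 (Nat.cast_nonneg _) hZ0.le
    nlinarith

end LowerBounds


end Literature.Computability.AlgebraicComplexity
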